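import Literature.NumberTheory.ConnesConsani2021.QuasiInnerBlaschkeDivision
import Literature.NumberTheory.ConnesConsani2021.QuasiInnerPrimeOffDiag
import HarnessLib

/-!
# Connes–Consani 2021 (JNT 226), Prop. 3.7 (ii): the kernel of `(1 − 𝒫)ρ(u_p)𝒫` on `H²` is cut out by the
zeros `x_p(n)`

LABEL: RH-FREE (unconditional operator/function theory on the circle; `bears_on: W-C/W-P` — infrastructure for
the typed fact `QuasiInner.prop_3_7`). WHAT THIS IS NOT: no statement about zeros of `ζ`, no spectral
realization, nothing here bears on the truth of RH.

Contents (theorems only; no new definitions, no new named facts):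
* §A the poles `x_p(n) = (4πn − i log p)/(4πn + 3i log p)`: nonzero, pairwise distinct, `→ 1` as `|n| → ∞`.
* §B moment uniqueness with complex nodes: `c ∈ ℓ¹(ι)`, `x_n` distinct nonzero points of the open unit disc
  accumulating only at `1`, `Σ_n c_n x_n^k = 0` for all `k ≥ 0` ⟹ `c = 0` (the function `Σ c_n/(1 − x_n w)`
  vanishes identically off the countable closed singular set; isolate each simple pole).
* §C `hardyOffDiag_kappaPrime_eq_zero_iff`: for every `f ∈ L²(S¹)`, `(1 − 𝒫)ρ(u_p)𝒫 f = 0` iff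
  `⟨η_{x_p(n)} | f⟩ = 0` for all `n ∈ ℤ` — from the strong rank-one expansion «offdiag2»
  (`display_offdiag2_holds`) and §B.  This is the step «the kernel … is formed of functions of `H²(𝒰)` which
  vanish on all zeros of `B`» of the printed proof of Prop. 3.7 (ii).

## References
* [CC21] A. Connes, C. Consani, *Quasi-inner functions and local factors*, J. Number Theory 226 (2021),
  arXiv:2008.10974 — §3, Prop. 3.7 and its proof (bib key `ConnesConsani2021QuasiInner`).
-/

noncomputable section

open _root_.MeasureTheory _root_.Complex AddCircle Filter Set Metric
open scoped Real NNReal ENNReal InnerProductSpace Topology ComplexConjugate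

namespace Literature.NumberTheory.ConnesConsani2021

namespace QuasiInner

/-! ### §A. The poles `x_p(n)` -/

/-- The denominators `4πn + 3i log p` do not vanish. [folklore] -/
private theorem bk_den_ne_zero {p : ℕ} (hp : 1 < p) (n : ℤ) : (4 * π * n + 3 * I * Real.log p : ℂ) ≠ 0 := by
  have hlog : 0 < Real.log p := Real.log_pos (by exact_mod_cast hp)
  set L : ℝ := Real.log p
  intro h
  have := congrArg Complex.im h
  simp at this
  linarith

/-- RH-FREE. `x_p(n) ≠ 0`. [cite: ConnesConsani2021QuasiInner, §3 (arXiv chunk p0008:L50)] -/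
theorem xPrime_ne_zero {p : ℕ} (hp : 1 < p) (n : ℤ) : xPrime p n ≠ 0 := by
  have hlog : 0 < Real.log p := Real.log_pos (by exact_mod_cast hp)
  rw [xPrime]
  refine div_ne_zero ?_ (bk_den_ne_zero hp n)
  set L : ℝ := Real.log p
  intro h
  have := congrArg Complex.im h
  simp at this
  linarith

/-- RH-FREE. `x_p(n) = 1 − 4i log p/(4πn + 3i log p)`. [cite: ConnesConsani2021QuasiInner, §3 (arXiv chunk p0008:L50)] -/
theorem xPrime_eq_one_sub {p : ℕ} (hp : 1 < p) (n : ℤ) :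
    xPrime p n = 1 - 4 * I * Real.log p / (4 * π * n + 3 * I * Real.log p) := by
  have hd := bk_den_ne_zero hp n
  rw [xPrime, eq_sub_iff_add_eq, ← add_div, div_eq_one_iff_eq hd]
  ring

/-- RH-FREE. The poles `x_p(n)`, `n ∈ ℤ`, are pairwise distinct. [cite: ConnesConsani2021QuasiInner, §3 (arXiv chunk p0008:L50)] -/
theorem xPrime_injective {p : ℕ} (hp : 1 < p) : Function.Injective (xPrime p) := by
  intro n m h
  have hlog : 0 < Real.log p := Real.log_pos (by exact_mod_cast hp)
  rw [xPrime_eq_one_sub hp, xPrime_eq_one_sub hp, sub_right_inj,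
    div_eq_div_iff (bk_den_ne_zero hp n) (bk_den_ne_zero hp m)] at h
  have h4 : (4 * I * Real.log p : ℂ) ≠ 0 := by
    set L : ℝ := Real.log p
    intro h0
    have := congrArg Complex.im h0
    simp at this
    linarith
  have h2 : (4 * π * m : ℂ) = 4 * π * n := add_right_cancel (mul_left_cancel₀ h4 h)
  have hπ : (4 * π : ℂ) ≠ 0 := by exact_mod_cast (by positivity : (4 * π : ℝ) ≠ 0)
  have h3 : (m : ℂ) = n := mul_left_cancel₀ hπ h2
  exact_mod_cast h3.symm

/-- RH-FREE. `x_p(n) → 1` as `|n| → ∞` (the poles accumulate only at `v = 1`).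
[cite: ConnesConsani2021QuasiInner, Prop 3.7, proof (arXiv chunk p0009:L57–L61)] -/
theorem tendsto_xPrime_cofinite {p : ℕ} (hp : 1 < p) : Tendsto (xPrime p) cofinite (𝓝 1) := by
  have hlog : 0 < Real.log p := Real.log_pos (by exact_mod_cast hp)
  have e : xPrime p = fun n : ℤ => 1 - 4 * I * Real.log p / (4 * π * n + 3 * I * Real.log p) :=
    funext (xPrime_eq_one_sub hp)
  rw [e, show 𝓝 (1 : ℂ) = 𝓝 (1 - 0) by rw [sub_zero]]
  set L : ℝ := Real.log p with hL
  refine tendsto_const_nhds.sub ?_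
  have hnorm : Tendsto (fun n : ℤ => ‖n‖) cofinite atTop := by
    rw [← cocompact_eq_cofinite ℤ]
    exact tendsto_norm_cocompact_atTop
  have hmaj : Tendsto (fun n : ℤ => L / π * ‖n‖⁻¹) cofinite (𝓝 0) := by
    simpa using (tendsto_inv_atTop_zero.comp hnorm).const_mul (L / π)
  refine squeeze_zero_norm' ?_ hmaj
  filter_upwards [eventually_cofinite_ne 0] with n hn
  have hre : |((4 * π * n + 3 * I * L : ℂ)).re| = 4 * π * ‖n‖ := by
    have : ((4 * π * n + 3 * I * L : ℂ)).re = 4 * π * n := by simp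
    rw [this, abs_mul, abs_of_pos (by positivity : (0:ℝ) < 4 * π), Int.norm_eq_abs]
  have hden : 4 * π * ‖n‖ ≤ ‖(4 * π * n + 3 * I * L : ℂ)‖ := hre ▸ Complex.abs_re_le_norm _
  have hnpos : 0 < ‖n‖ := norm_pos_iff.2 hn
  have hn0 : ‖n‖ ≠ 0 := hnpos.ne'
  have hnum : ‖(4 * I * L : ℂ)‖ = 4 * L := by
    rw [norm_mul, norm_mul, Complex.norm_I, Complex.norm_real, Real.norm_of_nonneg hlog.le]; norm_num
  rw [norm_div, hnum]
  calc 4 * L / ‖(4 * π * n + 3 * I * L : ℂ)‖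
      ≤ 4 * L / (4 * π * ‖n‖) := div_le_div_of_nonneg_left (by positivity) (by positivity) hden
    _ = L / π * ‖n‖⁻¹ := by field_simp

/-- The weights of «offdiag2» do not vanish. [folklore] -/
private theorem bk_coeff_ne_zero {p : ℕ} (hp : 1 < p) (n : ℤ) :
    (8 * (1 - (p : ℂ)⁻¹) * Real.log p) / (4 * π * n + 3 * I * Real.log p) ^ 2 ≠ 0 := by
  have hlog : 0 < Real.log p := Real.log_pos (by exact_mod_cast hp)
  have hp0 : (p : ℂ) ≠ 0 := by exact_mod_cast (by omega : p ≠ 0)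
  have hp1 : (1 - (p : ℂ)⁻¹) ≠ 0 := by
    rw [sub_ne_zero, ne_comm, Ne, inv_eq_one]
    exact_mod_cast (by omega : p ≠ 1)
  refine div_ne_zero (mul_ne_zero (mul_ne_zero (by norm_num) hp1) ?_) (pow_ne_zero _ (bk_den_ne_zero hp n))
  exact_mod_cast hlog.ne'

/-! ### §B. Moment uniqueness with complex nodes -/

/-- A family of nonzero complex numbers tending to `1` along the cofinite filter is bounded away from `0`.
[folklore] -/
private theorem bk_exists_pos_le_norm {ι : Type*} {x : ι → ℂ} (hx0 : ∀ n, x n ≠ 0)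
    (hlim : Tendsto x cofinite (𝓝 1)) : ∃ c₀ : ℝ, 0 < c₀ ∧ ∀ n, c₀ ≤ ‖x n‖ := by
  classical
  have hev : ∀ᶠ n in cofinite, (1/2 : ℝ) ≤ ‖x n‖ := by
    have h : Tendsto (fun n => ‖x n‖) cofinite (𝓝 ‖(1:ℂ)‖) := hlim.norm
    rw [norm_one] at h
    exact h.eventually (eventually_ge_nhds (by norm_num))
  have hfin : {n | ¬ ((1/2 : ℝ) ≤ ‖x n‖)}.Finite := hev
  set s : Finset ℝ := insert (1/2 : ℝ) (hfin.toFinset.image fun n => ‖x n‖) with hs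
  have hne : s.Nonempty := Finset.insert_nonempty _ _
  refine ⟨s.min' hne, ?_, fun n => ?_⟩
  · rw [Finset.lt_min'_iff]
    intro y hy
    rw [Finset.mem_insert, Finset.mem_image] at hy
    rcases hy with rfl | ⟨n, -, rfl⟩
    · norm_num
    · exact norm_pos_iff.2 (hx0 n)
  · by_cases hn : (1/2 : ℝ) ≤ ‖x n‖
    · exact (Finset.min'_le _ _ (Finset.mem_insert_self _ _)).trans hn
    · exact Finset.min'_le _ _ (Finset.mem_insert_of_mem
        (Finset.mem_image.2 ⟨n, by simpa [Set.Finite.mem_toFinset] using hn, rfl⟩))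

/-- For `x ≠ 0`: `‖1 − xz‖ = ‖x‖·‖x⁻¹ − z‖`. [folklore] -/
private theorem bk_norm_one_sub_mul_eq {x : ℂ} (hx : x ≠ 0) (z : ℂ) :
    ‖1 - x * z‖ = ‖x‖ * ‖x⁻¹ - z‖ := by
  have : 1 - x * z = x * (x⁻¹ - z) := by rw [mul_sub, mul_inv_cancel₀ hx]
  rw [this, norm_mul]

/-- Uniform lower bound for `‖1 − x_n z‖` on a ball that stays `ε/2`-away from the `x_n⁻¹`. [folklore] -/
private theorem bk_norm_one_sub_mul_ge {ι : Type*} {x : ι → ℂ} {c₀ : ℝ} (hc₀le : ∀ n, c₀ ≤ ‖x n‖)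
    (hx0 : ∀ n, x n ≠ 0) {w₀ : ℂ} {ε : ℝ} (hε : 0 ≤ ε) {P : ι → Prop}
    (hfar : ∀ n, P n → ε ≤ ‖(x n)⁻¹ - w₀‖) {z : ℂ} (hz : z ∈ ball w₀ (ε / 2)) {n : ι} (hn : P n) :
    c₀ * (ε / 2) ≤ ‖1 - x n * z‖ := by
  rw [bk_norm_one_sub_mul_eq (hx0 n)]
  have h1 : ε / 2 ≤ ‖(x n)⁻¹ - z‖ := by
    have hz' : ‖z - w₀‖ < ε / 2 := mem_ball_iff_norm.1 hz
    have := hfar n hn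
    linarith [norm_sub_le_norm_sub_add_norm_sub ((x n)⁻¹) z w₀]
  exact mul_le_mul (hc₀le n) h1 (by linarith) (norm_nonneg _)

/-- RH-FREE. **Moment uniqueness, complex nodes.** Let `c ∈ ℓ¹(ι)` (`ι` countable) and let `x_n` be distinct
nonzero points of the open unit disc with `x_n → 1` along the cofinite filter. If `Σ_n c_n x_n^k = 0` for every
`k ≥ 0`, then `c = 0`.  Proof: `Φ(w) = Σ_n c_n/(1 − x_n w)` is holomorphic off the countable closed set
`{x_n⁻¹} ∪ {1}`, whose complement is connected; on the unit disc `Φ(w) = Σ_k (Σ_n c_n x_n^k) w^k = 0`, so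
`Φ ≡ 0`; isolating the simple pole at `x_m⁻¹` gives `c_m = 0`.  (The tree's form of the printed step «the
kernel … is formed of functions which vanish on all zeros `x_p(n)`», obtained from the rank-one expansion
«offdiag2» rather than from the meromorphic continuation of `κ_p f`.)
[cite: ConnesConsani2021QuasiInner, Prop 3.7 (ii), proof (arXiv chunk p0010:L4–L7), proof step] -/
theorem eq_zero_of_forall_tsum_mul_pow_eq_zero_of_tendsto_cofinite {ι : Type*} [Countable ι]
    {c : ι → ℂ} (hc : Summable fun n => ‖c n‖)
    {x : ι → ℂ} (hx1 : ∀ n, ‖x n‖ < 1) (hx0 : ∀ n, x n ≠ 0) (hinj : Function.Injective x)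
    (hlim : Tendsto x cofinite (𝓝 1)) (h : ∀ k : ℕ, ∑' n, c n * x n ^ k = 0) : c = 0 := by
  classical
  obtain ⟨c₀, hc₀, hc₀le⟩ := bk_exists_pos_le_norm hx0 hlim
  -- the poles `w_n = x_n⁻¹ → 1`
  set w : ι → ℂ := fun n => (x n)⁻¹ with hw_def
  have hwlim : Tendsto w cofinite (𝓝 1) := by
    simpa [hw_def] using hlim.inv₀ one_ne_zero
  have hnormw : ∀ n, 1 < ‖w n‖ := by
    intro n
    rw [hw_def]
    simp only [norm_inv]
    exact one_lt_inv_iff₀.2 ⟨norm_pos_iff.2 (hx0 n), hx1 n⟩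
  -- the singular set `S` and its complement `U`
  set S : Set ℂ := insert 1 (range w) with hS_def
  have hSclosed : IsClosed S := hwlim.isCompact_insert_range_of_cofinite.isClosed
  have hScount : S.Countable := (countable_range w).insert 1
  set U : Set ℂ := Sᶜ with hU_def
  have hUopen : IsOpen U := hSclosed.isOpen_compl
  have hUconn : IsPreconnected U :=
    (hScount.isConnected_compl_of_one_lt_rank (by simp)).isPreconnected
  have hballU : ball (0:ℂ) 1 ⊆ U := by
    intro z hz
    rw [mem_ball_zero_iff] at hz
    rw [hU_def, mem_compl_iff, hS_def, mem_insert_iff, mem_range, not_or, not_exists]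
    refine ⟨fun h1 => ?_, fun n hn => ?_⟩
    · rw [h1, norm_one] at hz; exact lt_irrefl _ hz
    · have := hnormw n; rw [hn] at this; linarith
  -- the terms and their sum `Φ`
  set f : ι → ℂ → ℂ := fun n z => c n / (1 - x n * z) with hf_def
  set Φ : ℂ → ℂ := fun z => ∑' n, f n z with hΦ_def
  -- local uniform control near any point of `U`, or near a pole with that pole removed
  have hloc : ∀ (w₀ : ℂ) (ε : ℝ), 0 < ε → ∀ P : ι → Prop, (∀ n, P n → ε ≤ ‖w n - w₀‖) →
      ∀ z ∈ ball w₀ (ε / 2), ∀ n, P n →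
        (1 - x n * z ≠ 0) ∧ ‖f n z‖ ≤ ‖c n‖ / (c₀ * (ε / 2)) := by
    intro w₀ ε hε P hfar z hz n hn
    have hb := bk_norm_one_sub_mul_ge hc₀le hx0 hε.le hfar hz hn
    have hpos : 0 < c₀ * (ε / 2) := by positivity
    have hne : 1 - x n * z ≠ 0 := by
      intro h0; rw [h0, norm_zero] at hb; linarith
    refine ⟨hne, ?_⟩
    rw [hf_def]
    simp only [norm_div]
    exact div_le_div_of_nonneg_left (norm_nonneg _) hpos hb
  -- `Φ` is holomorphic on `U`
  have hΦdiff : DifferentiableOn ℂ Φ U := by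
    intro w₀ hw₀
    obtain ⟨ε, hε, hball⟩ := Metric.isOpen_iff.1 hUopen w₀ hw₀
    have hfar : ∀ n, True → ε ≤ ‖w n - w₀‖ := by
      intro n _
      by_contra hlt
      push Not at hlt
      have : w n ∈ U := hball (mem_ball_iff_norm.2 hlt)
      exact this (mem_insert_of_mem _ (mem_range_self n))
    have hdiff : DifferentiableOn ℂ Φ (ball w₀ (ε / 2)) := by
      refine differentiableOn_tsum_of_summable_norm (u := fun n => ‖c n‖ / (c₀ * (ε / 2)))
        (hc.div_const _) (fun n => ?_) isOpen_ball fun n z hz => ((hloc w₀ ε hε _ hfar z hz n trivial).2)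
      refine DifferentiableOn.div (differentiableOn_const _) (by fun_prop) fun z hz => ?_
      exact (hloc w₀ ε hε _ hfar z hz n trivial).1
    exact (hdiff.differentiableAt (isOpen_ball.mem_nhds (mem_ball_self (by positivity)))).differentiableWithinAt
  -- `Φ = 0` on the unit disc
  have hΦball : ∀ z ∈ ball (0:ℂ) 1, Φ z = 0 := by
    intro z hz
    rw [mem_ball_zero_iff] at hz
    have hxz' : ∀ n, ‖x n‖ * ‖z‖ ≤ ‖z‖ := by
      intro n
      calc ‖x n‖ * ‖z‖ ≤ 1 * ‖z‖ := mul_le_mul_of_nonneg_right (hx1 n).le (norm_nonneg _)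
        _ = ‖z‖ := one_mul _
    have hxz : ∀ n, ‖x n * z‖ ≤ ‖z‖ := fun n => (norm_mul _ _).trans_le (hxz' n)
    have hq : ∀ n, ‖x n * z‖ < 1 := fun n => (hxz n).trans_lt hz
    -- the double series `Σ_{n,k} c_n (x_n z)^k` is absolutely summable
    have hF : Summable (Function.uncurry fun n k => c n * (x n * z) ^ k) := by
      have h2 : Summable fun q : ι × ℕ => c q.1 * z ^ q.2 :=
        summable_mul_of_summable_norm hc (by
          simpa [norm_pow] using summable_geometric_of_lt_one (norm_nonneg _) hz)
      refine Summable.of_norm_bounded (g := fun q : ι × ℕ => ‖c q.1 * z ^ q.2‖) h2.norm ?_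
      rintro ⟨n, k⟩
      simp only [Function.uncurry_apply_pair, norm_mul, norm_pow]
      exact mul_le_mul_of_nonneg_left (pow_le_pow_left₀ (by positivity) (hxz' n) k) (norm_nonneg _)
    calc Φ z = ∑' n, c n * ∑' k, (x n * z) ^ k := by
          simp only [hΦ_def, hf_def]
          refine tsum_congr fun n => ?_
          rw [tsum_geometric_of_norm_lt_one (hq n), div_eq_mul_inv]
      _ = ∑' n, ∑' k, c n * (x n * z) ^ k := by
          refine tsum_congr fun n => ?_; rw [tsum_mul_left]
      _ = ∑' k, ∑' n, c n * (x n * z) ^ k := (hF.tsum_comm).symm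
      _ = ∑' k, z ^ k * ∑' n, c n * x n ^ k := by
          refine tsum_congr fun k => ?_
          rw [← tsum_mul_left]
          refine tsum_congr fun n => ?_
          rw [mul_pow]; ring
      _ = 0 := by simp [h]
  -- identity theorem: `Φ = 0` on `U`
  have hΦU : EqOn Φ 0 U := by
    have hanal : AnalyticOnNhd ℂ Φ U := hΦdiff.analyticOnNhd hUopen
    refine hanal.eqOn_zero_of_preconnected_of_eventuallyEq_zero hUconn (hballU (mem_ball_self one_pos)) ?_
    exact Filter.eventuallyEq_iff_exists_mem.2 ⟨ball 0 1, isOpen_ball.mem_nhds (mem_ball_self one_pos),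
      fun z hz => hΦball z hz⟩
  -- isolate the pole at `w m = x_m⁻¹`
  funext m
  -- the singular set with the `m`-th pole replaced by the limit point `1`
  set w' : ι → ℂ := fun n => if n = m then 1 else w n with hw'_def
  have hw'lim : Tendsto w' cofinite (𝓝 1) := by
    refine hwlim.congr' ?_
    filter_upwards [eventually_cofinite_ne m] with n hn
    rw [hw'_def]; simp [hn]
  set S' : Set ℂ := insert 1 (range w') with hS'_def
  have hS'closed : IsClosed S' := hw'lim.isCompact_insert_range_of_cofinite.isClosed
  have hwm : w m ∉ S' := by
    rw [hS'_def, mem_insert_iff, mem_range, not_or, not_exists]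
    refine ⟨fun h1 => ?_, fun n hn => ?_⟩
    · have := hnormw m; rw [h1, norm_one] at this; exact lt_irrefl _ this
    · rw [hw'_def] at hn
      by_cases hnm : n = m
      · simp only [hnm, if_true] at hn
        have := hnormw m; rw [← hn, norm_one] at this; exact lt_irrefl _ this
      · simp only [hnm, if_false, hw_def] at hn
        exact hnm (hinj (inv_injective hn))
  obtain ⟨ρ, hρ, hρball⟩ := Metric.isOpen_iff.1 hS'closed.isOpen_compl (w m) hwm
  have hfar : ∀ n, n ≠ m → ρ ≤ ‖w n - w m‖ := by
    intro n hn
    by_contra hlt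
    push Not at hlt
    have h1 : w n ∈ S'ᶜ := hρball (mem_ball_iff_norm.2 hlt)
    exact h1 (mem_insert_of_mem _ ⟨n, by rw [hw'_def]; simp [hn]⟩)
  -- the regular part `Φ_m` near `w m`
  set Φm : ℂ → ℂ := fun z => ∑' n, if n = m then 0 else f n z with hΦm_def
  have hΦm_cont : ContinuousOn Φm (ball (w m) (ρ / 2)) := by
    refine continuousOn_tsum (u := fun n => ‖c n‖ / (c₀ * (ρ / 2))) (fun n => ?_) (hc.div_const _)
      fun n z hz => ?_
    · by_cases hnm : n = m
      · simp only [hnm, if_true]; exact continuousOn_const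
      · simp only [hnm, if_false]
        refine ContinuousOn.div continuousOn_const (by fun_prop) fun z hz => ?_
        exact (hloc (w m) ρ hρ (fun n => n ≠ m) hfar z hz n hnm).1
    · by_cases hnm : n = m
      · simp only [hnm, if_true, norm_zero]; positivity
      · simp only [hnm, if_false]
        exact (hloc (w m) ρ hρ (fun n => n ≠ m) hfar z hz n hnm).2
  -- on the punctured ball: `c m = −(1 − x_m z) Φ_m(z)`
  have hpunct : ∀ z ∈ ball (w m) (ρ / 2), z ≠ w m → c m = -(1 - x m * z) * Φm z := by
    intro z hz hzm
    have hzU : z ∈ U := by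
      rw [hU_def, mem_compl_iff, hS_def, mem_insert_iff, mem_range, not_or, not_exists]
      have hz' : ‖z - w m‖ < ρ / 2 := mem_ball_iff_norm.1 hz
      refine ⟨fun h1 => ?_, fun n hn => ?_⟩
      · have hfar1 : ρ ≤ ‖1 - w m‖ := by
          by_contra hlt
          push Not at hlt
          exact hρball (mem_ball_iff_norm.2 hlt) (mem_insert _ _)
        rw [h1] at hz'; linarith
      · by_cases hnm : n = m
        · rw [hnm] at hn; exact hzm hn.symm
        · have := hfar n hnm; rw [hn] at this; linarith
    have hΦz : Φ z = 0 := hΦU hzU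
    -- split off the `m`-th term
    have hg : Summable fun n => if n = m then 0 else f n z :=
      Summable.of_norm_bounded (g := fun n => ‖c n‖ / (c₀ * (ρ / 2))) (hc.div_const _) fun n => by
        by_cases hnm : n = m
        · simp only [hnm, if_true, norm_zero]; positivity
        · simp only [hnm, if_false]
          exact (hloc (w m) ρ hρ (fun n => n ≠ m) hfar z hz n hnm).2
    have he : HasSum (fun n => if n = m then f m z else 0) (f m z) := hasSum_ite_eq m (f m z)
    have hsplit : Φ z = f m z + Φm z := by
      have hfg : (fun n => f n z) = fun n => (if n = m then f m z else 0) + (if n = m then 0 else f n z) := by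
        funext n
        by_cases hnm : n = m
        · subst hnm; simp
        · simp [hnm]
      rw [hΦ_def]
      simp only
      rw [hfg, he.summable.tsum_add hg, he.tsum_eq]
    have hne : 1 - x m * z ≠ 0 := by
      rw [sub_ne_zero]
      intro h1
      apply hzm
      rw [hw_def]
      exact eq_inv_of_mul_eq_one_right h1.symm
    rw [hΦz, hf_def] at hsplit
    simp only at hsplit
    field_simp at hsplit
    linear_combination -hsplit
  -- let `z → w m`
  have hψ : ContinuousOn (fun z => -(1 - x m * z) * Φm z) (ball (w m) (ρ / 2)) :=
    (ContinuousOn.neg (by fun_prop)).mul hΦm_cont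
  have hψ0 : -(1 - x m * w m) * Φm (w m) = 0 := by
    rw [hw_def]
    simp only
    rw [mul_inv_cancel₀ (hx0 m), sub_self, neg_zero, zero_mul]
  have htend : Tendsto (fun z => -(1 - x m * z) * Φm z) (𝓝[≠] (w m)) (𝓝 0) := by
    have h1 := (hψ (w m) (mem_ball_self (by positivity))).continuousAt
      (isOpen_ball.mem_nhds (mem_ball_self (by positivity)))
    rw [ContinuousAt, hψ0] at h1
    exact h1.mono_left nhdsWithin_le_nhds
  have hconst : Tendsto (fun _ : ℂ => c m) (𝓝[≠] (w m)) (𝓝 0) := by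
    refine htend.congr' ?_
    have hmem : {w m}ᶜ ∩ ball (w m) (ρ / 2) ∈ 𝓝[≠] (w m) :=
      inter_mem_nhdsWithin _ (isOpen_ball.mem_nhds (mem_ball_self (x := w m) (half_pos hρ)))
    filter_upwards [hmem] with z hz
    exact (hpunct z hz.2 hz.1).symm
  simpa using (tendsto_nhds_unique hconst tendsto_const_nhds).symm

/-! ### §C. The kernel of `(1 − 𝒫)ρ(u_p)𝒫` is cut out by the evaluations at the `x_p(n)` -/

/-- Unconditional summability in `ℂ` is absolute summability. [folklore] -/
private theorem bk_summable_norm_of_summable {ι : Type*} {g : ι → ℂ} (hg : Summable g) :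
    Summable fun n => ‖g n‖ := by
  have hre : Summable fun n => |(g n).re| := by
    have h1 : Summable fun n => (g n).re := by simpa using Complex.reCLM.summable hg
    exact summable_abs_iff.2 h1
  have him : Summable fun n => |(g n).im| := by
    have h1 : Summable fun n => (g n).im := by simpa using Complex.imCLM.summable hg
    exact summable_abs_iff.2 h1
  exact Summable.of_nonneg_of_le (fun n => norm_nonneg _) (fun n => Complex.norm_le_abs_re_add_abs_im (g n))
    (hre.add him)

/-- RH-FREE. The «offdiag2» expansion tested against a negative mode: for every `f ∈ L²(S¹)` and `k ≥ 0`,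
`⟨e_{−k−1} | (1 − 𝒫)ρ(u_p)𝒫 f⟩ = Σ_{n∈ℤ} γ_n ⟨η_{x_p(n)} | f⟩ x_p(n)^k`, `γ_n = 8(1 − p⁻¹) log p/(4πn + 3i log p)²`.
[cite: ConnesConsani2021QuasiInner, §3 display «offdiag2» (arXiv chunk p0008:L74)] -/
theorem hasSum_inner_fourierLp_negSucc_hardyOffDiag_kappaPrime {p : ℕ} (hp : p.Prime)
    (f : Lp ℂ 2 (haarAddCircle (T := (1:ℝ)))) (k : ℕ) :
    HasSum (fun n : ℤ => ((8 * (1 - (p : ℂ)⁻¹) * Real.log p) / (4 * π * n + 3 * I * Real.log p) ^ 2) *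
        ⟪etaVec 1 (xPrime p n), f⟫_ℂ * xPrime p n ^ k)
      ⟪fourierLp (T := (1:ℝ)) 2 (-(k + 1 : ℤ)),
        hardyOffDiag 1 (toLpOrZero ∞ haarAddCircle (circleRestrict 1 (kappaPrime p))) f⟫_ℂ := by
  have h := (innerSL ℂ (fourierLp (T := (1:ℝ)) 2 (-(k + 1 : ℤ)))).hasSum (display_offdiag2_holds p hp f)
  simp only [innerSL_apply_apply, smul_apply, InnerProductSpace.rankOne_apply, inner_smul_right,
    inner_fourierLp_negSucc_xiVec (T := (1:ℝ)) _ (norm_xPrime_lt_one hp.one_lt _)] at h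
  exact h.congr_fun fun n => by ring

/-- RH-FREE. **The kernel of `(1 − 𝒫)ρ(u_p)𝒫` is cut out by the zeros `x_p(n)`**: for every `f ∈ L²(S¹)`,
`(1 − 𝒫)ρ(u_p)𝒫 f = 0` iff `⟨η_{x_p(n)} | f⟩ = 0` for all `n ∈ ℤ`; in particular
`K := ker((1 − 𝒫)ρ(u_p)𝒫) ∩ H²(𝒰)` «is formed of functions of `H²(𝒰)` which vanish on all zeros of `B`»
(`x_p(n)`, `n ∈ ℤ`).  (⇐) is termwise; (⇒) tests the strong expansion «offdiag2» against the modes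
`e_{−k−1}` and applies moment uniqueness (§B) to `γ_n⟨η_{x_p(n)} | f⟩ ∈ ℓ¹(ℤ)`.
[cite: ConnesConsani2021QuasiInner, Prop 3.7 (ii), proof (arXiv chunk p0010:L4–L7)] -/
theorem hardyOffDiag_kappaPrime_eq_zero_iff {p : ℕ} (hp : p.Prime)
    (f : Lp ℂ 2 (haarAddCircle (T := (1:ℝ)))) :
    hardyOffDiag 1 (toLpOrZero ∞ haarAddCircle (circleRestrict 1 (kappaPrime p))) f = 0 ↔
      ∀ n : ℤ, ⟪etaVec 1 (xPrime p n), f⟫_ℂ = 0 := by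
  have hp1 := hp.one_lt
  constructor
  · intro hA n₀
    set a : ℤ → ℂ := fun n => ((8 * (1 - (p : ℂ)⁻¹) * Real.log p) / (4 * π * n + 3 * I * Real.log p) ^ 2) *
      ⟪etaVec 1 (xPrime p n), f⟫_ℂ with ha
    have hmom : ∀ k : ℕ, HasSum (fun n : ℤ => a n * xPrime p n ^ k) 0 := by
      intro k
      have h := hasSum_inner_fourierLp_negSucc_hardyOffDiag_kappaPrime hp f k
      rwa [hA, inner_zero_right] at h
    have hsum : Summable fun n => ‖a n‖ := by
      refine bk_summable_norm_of_summable ?_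
      simpa using (hmom 0).summable
    have hzero := eq_zero_of_forall_tsum_mul_pow_eq_zero_of_tendsto_cofinite hsum
      (norm_xPrime_lt_one hp1) (xPrime_ne_zero hp1) (xPrime_injective hp1) (tendsto_xPrime_cofinite hp1)
      (fun k => (hmom k).tsum_eq)
    have h0 : a n₀ = 0 := by rw [hzero]; rfl
    rcases mul_eq_zero.1 h0 with h1 | h1
    · exact absurd h1 (bk_coeff_ne_zero hp1 n₀)
    · exact h1
  · intro hz
    have h := display_offdiag2_holds p hp f
    have hterm : (fun n : ℤ => (((8 * (1 - (p : ℂ)⁻¹) * Real.log p) / (4 * π * n + 3 * I * Real.log p) ^ 2) •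
        InnerProductSpace.rankOne ℂ (xiVec 1 (xPrime p n)) (etaVec 1 (xPrime p n))) f) = fun _ => 0 := by
      funext n
      rw [smul_apply, InnerProductSpace.rankOne_apply, hz n, zero_smul, smul_zero]
    rw [hterm] at h
    exact h.unique hasSum_zero

/-- RH-FREE. Corollary: on `H²`, membership in `K = ker((1 − 𝒫)ρ(u_p)𝒫) ∩ H²` is vanishing at all `x_p(n)`.
[cite: ConnesConsani2021QuasiInner, Prop 3.7 (ii), proof (arXiv chunk p0010:L4–L7)] -/
theorem mem_ker_hardyOffDiag_kappaPrime_inf_hardySpace_iff {p : ℕ} (hp : p.Prime)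
    (f : Lp ℂ 2 (haarAddCircle (T := (1:ℝ)))) :
    f ∈ LinearMap.ker (hardyOffDiag 1 (toLpOrZero ∞ haarAddCircle (circleRestrict 1 (kappaPrime p)))).toLinearMap
        ⊓ hardySpace 1 ↔
      f ∈ hardySpace 1 ∧ ∀ n : ℤ, ⟪etaVec 1 (xPrime p n), f⟫_ℂ = 0 := by
  rw [Submodule.mem_inf, LinearMap.mem_ker, ContinuousLinearMap.coe_coe, hardyOffDiag_kappaPrime_eq_zero_iff hp,
    and_comm]

end QuasiInner

end Literature.NumberTheory.ConnesConsani2021
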